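import Mathlib
import Literature.NumberTheory.Sieve.RoughOmegaCells
import Summits.Parity.GeneralizedHardyLittlewood.Theorems.ParityLeakOneFifthPlainSplitCalibReductionDivisors
import Summits.Parity.GeneralizedHardyLittlewood.Theorems.ParityLeakOneFifthPlainSplitCalibReductionPointwise
import HarnessLib

/-!
# Route ParityLeakOneFifth, crux `PlainSplit` (stmt-Parity-18382), skeleton `calib-split`:
# stub `stub_calibReduction`

With `y = x^{1/5}`, `w = x^{ε²}`, `D = x^{1/2−2ε}`, `G(m) = Σ_{d ∣ m, d ≤ D, d y-rough} μ(d)`: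
the exact split `Σ_{n z-rough} λ(n+2)Φ(n+2) = A_w − A_y` (`sum_liouville_Phi_split`), the count
`#{n ≤ 2x : n+2 not squarefree, P⁻(n+2) ≥ y} ≤ 2x/y + √(2x+2) + 1` (`card_nonSquarefree_rough_le`),
the growth facts at `x ≥ 2^100` (`calib_growth`), and the assembled stub `stub_calibReduction`
(pointwise inequality of part II summed over `{n z-rough, y ≤ P⁻(n+2)}`).
-/

namespace Summit.Parity.GeneralizedHardyLittlewood.Theorems.ParityLeakOneFifth

open Finset
open scoped ArithmeticFunction.Omega ArithmeticFunction.Moebius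
open Literature.NumberTheory.Sieve
/-! ### Counting the non-squarefree rough shifts -/

/-- `#{n ∈ (x,2x] : q ∣ n+2} ≤ x/q + 1`. -/
theorem card_filter_dvd_shift_le (x : ℕ) {q : ℕ} (hq : 0 < q) :
    (#((Finset.Ioc x (2 * x)).filter (fun n : ℕ => q ∣ n + 2)) : ℝ) ≤ (x : ℝ) / q + 1 := by
  have hinj : #((Finset.Ioc x (2 * x)).filter (fun n : ℕ => q ∣ n + 2)) ≤
      #(Finset.Ioc ((x + 2) / q) ((2 * x + 2) / q)) := by
    refine Finset.card_le_card_of_injOn (fun n => (n + 2) / q) ?_ ?_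
    · intro n hn
      rw [Finset.mem_coe, Finset.mem_filter, Finset.mem_Ioc] at hn
      rw [Finset.mem_coe, Finset.mem_Ioc]
      obtain ⟨⟨h1, h2⟩, k, hk⟩ := hn
      simp only
      rw [hk, Nat.mul_div_cancel_left k hq]
      refine ⟨?_, ?_⟩
      · by_contra h
        push Not at h
        have h3 : q * ((x + 2) / q) ≤ x + 2 := Nat.mul_div_le (x + 2) q
        have h4 : q * k ≤ q * ((x + 2) / q) := Nat.mul_le_mul_left q h
        omega
      · rw [Nat.le_div_iff_mul_le hq]
        rw [mul_comm] at hk; omega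
    · intro a ha b hb h
      rw [Finset.mem_coe, Finset.mem_filter] at ha hb
      simp only at h
      have ha' := Nat.div_mul_cancel ha.2
      have hb' := Nat.div_mul_cancel hb.2
      have : a + 2 = b + 2 := by rw [← ha', ← hb', h]
      omega
  rw [Nat.card_Ioc] at hinj
  have hq' : (0 : ℝ) < q := by exact_mod_cast hq
  have hA : (((2 * x + 2) / q : ℕ) : ℝ) ≤ ((2 * x + 2 : ℕ) : ℝ) / q := Nat.cast_div_le
  have hB : ((x + 2 : ℕ) : ℝ) < (((x + 2) / q : ℕ) : ℝ) * q + q := by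
    exact_mod_cast Nat.lt_div_mul_add (a := x + 2) hq
  by_cases hle : (x + 2) / q ≤ (2 * x + 2) / q
  · have h1 : (#((Finset.Ioc x (2 * x)).filter (fun n : ℕ => q ∣ n + 2)) : ℝ) ≤
        (((2 * x + 2) / q : ℕ) : ℝ) - (((x + 2) / q : ℕ) : ℝ) := by
      have := hinj; rw [← Nat.cast_sub hle]; exact_mod_cast this
    have hB' : ((x + 2 : ℕ) : ℝ) / q - 1 < (((x + 2) / q : ℕ) : ℝ) := by
      rw [div_sub_one (ne_of_gt hq'), div_lt_iff₀ hq']; linarith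
    have e : ((2 * x + 2 : ℕ) : ℝ) / q - (((x + 2 : ℕ) : ℝ) / q - 1) = (x : ℝ) / q + 1 := by
      push_cast; field_simp; ring
    linarith
  · push Not at hle
    have : #((Finset.Ioc x (2 * x)).filter (fun n : ℕ => q ∣ n + 2)) = 0 := by
      have : (2 * x + 2) / q - (x + 2) / q = 0 := by omega
      omega
    rw [this]; push_cast; positivity

/-- The non-squarefree `y`-rough shifts are few:
`#{n ∈ (x,2x] : n+2 not squarefree, P⁻(n+2) ≥ y} ≤ 2x/y + √(2x+2) + 1`. -/
theorem card_nonSquarefree_rough_le (x : ℕ) {y : ℝ} (hy : 1 ≤ y) :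
    (#((Finset.Ioc x (2 * x)).filter (fun n : ℕ =>
        ¬ Squarefree (n + 2) ∧ y ≤ ((n + 2).minFac : ℝ))) : ℝ) ≤
      2 * (x : ℝ) / y + Nat.sqrt (2 * x + 2) + 1 := by
  set a : ℕ := ⌈y⌉₊ with ha
  set b : ℕ := Nat.sqrt (2 * x + 2) with hb
  have ha1 : 1 ≤ a := Nat.one_le_ceil_iff.2 (by linarith)
  have hya : y ≤ a := Nat.le_ceil y
  have hsub : (Finset.Ioc x (2 * x)).filter (fun n : ℕ =>
        ¬ Squarefree (n + 2) ∧ y ≤ ((n + 2).minFac : ℝ)) ⊆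
      (Finset.Icc a b).biUnion
        (fun q => (Finset.Ioc x (2 * x)).filter (fun n : ℕ => q * q ∣ n + 2)) := by
    intro n hn
    rw [Finset.mem_filter] at hn
    obtain ⟨hn, hnsq, hr⟩ := hn
    rw [Nat.squarefree_iff_prime_squarefree] at hnsq
    push Not at hnsq
    obtain ⟨p, hp, hdvd⟩ := hnsq
    rw [Finset.mem_biUnion]
    refine ⟨p, ?_, Finset.mem_filter.2 ⟨hn, hdvd⟩⟩
    rw [Finset.mem_Icc]
    refine ⟨?_, ?_⟩
    · have h1 : (n + 2).minFac ≤ p :=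
        Nat.minFac_le_of_dvd hp.two_le (dvd_trans (dvd_mul_right p p) hdvd)
      have h2 : y ≤ (p : ℝ) := hr.trans (by exact_mod_cast h1)
      exact Nat.ceil_le.2 h2
    · rw [hb, Nat.le_sqrt]
      have := Nat.le_of_dvd (by omega) hdvd
      rw [Finset.mem_Ioc] at hn
      exact this.trans (by omega)
  have h1 : (#((Finset.Ioc x (2 * x)).filter (fun n : ℕ =>
        ¬ Squarefree (n + 2) ∧ y ≤ ((n + 2).minFac : ℝ))) : ℝ) ≤
      ∑ q ∈ Finset.Icc a b, ((x : ℝ) / ((q : ℝ) * q) + 1) := by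
    calc (#((Finset.Ioc x (2 * x)).filter (fun n : ℕ =>
          ¬ Squarefree (n + 2) ∧ y ≤ ((n + 2).minFac : ℝ))) : ℝ)
          ≤ #((Finset.Icc a b).biUnion
            (fun q => (Finset.Ioc x (2 * x)).filter (fun n : ℕ => q * q ∣ n + 2))) := by
          exact_mod_cast Finset.card_le_card hsub
      _ ≤ ∑ q ∈ Finset.Icc a b, (#((Finset.Ioc x (2 * x)).filter (fun n : ℕ => q * q ∣ n + 2)) : ℝ) := by
          exact_mod_cast Finset.card_biUnion_le
      _ ≤ ∑ q ∈ Finset.Icc a b, ((x : ℝ) / ((q : ℝ) * q) + 1) := by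
          refine Finset.sum_le_sum fun q hq => ?_
          rw [Finset.mem_Icc] at hq
          have hq0 : 0 < q * q := Nat.mul_pos (by omega) (by omega)
          have := card_filter_dvd_shift_le x hq0
          push_cast at this
          exact this
  have h2 : ∑ q ∈ Finset.Icc a b, ((x : ℝ) / ((q : ℝ) * q) + 1) ≤ 2 * (x : ℝ) / y + b + 1 := by
    rw [Finset.sum_add_distrib, Finset.sum_const, nsmul_eq_mul, mul_one, Nat.card_Icc]
    have hs : ∑ q ∈ Finset.Icc a b, (x : ℝ) / ((q : ℝ) * q) ≤ 2 * (x : ℝ) / y := by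
      have hsub' : Finset.Icc a b ⊆ Finset.Ioo (a - 1) (b + 1) := by
        intro q hq
        rw [Finset.mem_Icc] at hq
        rw [Finset.mem_Ioo]; omega
      have e : ∀ q ∈ Finset.Icc a b, (x : ℝ) / ((q : ℝ) * q) = (x : ℝ) * ((q : ℝ) ^ 2)⁻¹ := by
        intro q _; rw [div_eq_mul_inv, pow_two]
      rw [Finset.sum_congr rfl e, ← Finset.mul_sum]
      have hI : ∑ q ∈ Finset.Icc a b, ((q : ℝ) ^ 2)⁻¹ ≤ 2 / y := by
        calc ∑ q ∈ Finset.Icc a b, ((q : ℝ) ^ 2)⁻¹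
            ≤ ∑ q ∈ Finset.Ioo (a - 1) (b + 1), ((q : ℝ) ^ 2)⁻¹ :=
              Finset.sum_le_sum_of_subset_of_nonneg hsub' (fun _ _ _ => by positivity)
          _ ≤ 2 / (((a - 1 : ℕ) : ℝ) + 1) := sum_Ioo_inv_sq_le (a - 1) (b + 1)
          _ = 2 / (a : ℝ) := by
              congr 1; rw [Nat.cast_sub ha1]; push_cast; ring
          _ ≤ 2 / y := div_le_div_of_nonneg_left (by norm_num) (by linarith) hya
      calc (x : ℝ) * ∑ q ∈ Finset.Icc a b, ((q : ℝ) ^ 2)⁻¹ ≤ (x : ℝ) * (2 / y) :=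
            mul_le_mul_of_nonneg_left hI (Nat.cast_nonneg x)
        _ = 2 * (x : ℝ) / y := by ring
    have hc : (((b + 1 - a : ℕ) : ℝ)) ≤ (b : ℝ) + 1 := by
      have : b + 1 - a ≤ b + 1 := Nat.sub_le _ _
      exact_mod_cast this
    linarith
  exact h1.trans h2

/-! ### Growth facts at `x ≥ 2^100` -/

/-- For `x ≥ 2^100`: `4 ≤ x^{1/50}`. -/
theorem four_le_rpow_fiftieth {x : ℕ} (hx : 2 ^ 100 ≤ x) : (4 : ℝ) ≤ (x : ℝ) ^ ((1 : ℝ) / 50) := by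
  have h : ((2 : ℝ) ^ (100 : ℕ)) ^ ((1 : ℝ) / 50) = (2 : ℝ) ^ (2 : ℕ) := by
    rw [← Real.rpow_natCast, ← Real.rpow_mul (by norm_num), ← Real.rpow_natCast]; norm_num
  rw [show (4 : ℝ) = (2 : ℝ) ^ (2 : ℕ) by norm_num, ← h]
  exact Real.rpow_le_rpow (by positivity) (by exact_mod_cast hx) (by norm_num)

/-! ### The split identity and the indicator sums -/

/-- `Σ_R λΦ = A_w − A_y` when `w ≤ y`. -/
theorem sum_liouville_Phi_split (S : Finset ℕ) (R : ℕ → Prop) [DecidablePred R] (w y : ℝ)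
    (hwy : w ≤ y) (G : ℕ → ℝ) :
    ∑ n ∈ S.filter (fun n => R n), (ArithmeticFunction.liouville (n + 2) : ℝ) *
        (if w ≤ ((n + 2).minFac : ℝ) ∧ ((n + 2).minFac : ℝ) < y then G (n + 2) else 0) =
      ∑ n ∈ S.filter (fun n => R n ∧ w ≤ ((n + 2).minFac : ℝ)),
          (ArithmeticFunction.liouville (n + 2) : ℝ) * G (n + 2) -
        ∑ n ∈ S.filter (fun n => R n ∧ y ≤ ((n + 2).minFac : ℝ)),
          (ArithmeticFunction.liouville (n + 2) : ℝ) * G (n + 2) := by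
  simp only [Finset.sum_filter]
  rw [← Finset.sum_sub_distrib]
  refine Finset.sum_congr rfl fun n _ => ?_
  by_cases hR : R n
  · by_cases h1 : w ≤ ((n + 2).minFac : ℝ)
    · by_cases h2 : y ≤ ((n + 2).minFac : ℝ)
      · simp only [hR, h1, h2, not_lt.2 h2, and_false, true_and, if_true, if_false]; ring
      · simp only [hR, h1, h2, not_le.1 h2, and_true, if_true, if_false, and_false]; ring
    · have h2 : ¬ y ≤ ((n + 2).minFac : ℝ) := fun h => h1 (hwy.trans h)
      simp only [hR, h1, h2, false_and, and_false, if_false, if_true]; ring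
  · simp only [hR, false_and, if_false]; ring

/-- Sum of an indicator over a finset is the cardinality of the filter. -/
theorem sum_ite_one_eq_card (S : Finset ℕ) (P : ℕ → Prop) [DecidablePred P] :
    ∑ n ∈ S, (if P n then (1 : ℝ) else 0) = #(S.filter (fun n => P n)) := by
  rw [Finset.sum_ite, Finset.sum_const_zero, add_zero, Finset.sum_const, nsmul_eq_mul, mul_one]

/-! ### Growth facts -/

/-- The growth facts at `x ≥ 2^100`, `0 < ε ≤ 1/25` (with `y = x^{1/5}`, `D = x^{1/2−2ε}`,
`w = x^{ε²}`). -/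
theorem calib_growth {ε : ℝ} (hε : 0 < ε) (hε' : ε ≤ 1 / 25) {x : ℕ} (hx : 2 ^ 100 ≤ x) :
    1 ≤ (x : ℝ) ^ ((1 : ℝ) / 5) ∧ 1 ≤ (x : ℝ) ^ ((1 : ℝ) / 2 - 2 * ε) ∧
    (x : ℝ) ^ (ε ^ 2) ≤ (x : ℝ) ^ ((1 : ℝ) / 5) ∧
    (x : ℝ) ^ ((1 : ℝ) / 2 - 2 * ε) < ((x : ℝ) ^ ((1 : ℝ) / 5)) ^ 3 ∧
    ((x : ℝ) ^ ((1 : ℝ) / 2 - 2 * ε)) ^ 2 ≤ (x : ℝ) ∧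
    (x : ℝ) ^ ((1 : ℝ) / 5) ≤ (x : ℝ) ∧
    2 * (x : ℝ) + 2 < ((x : ℝ) ^ ((1 : ℝ) / 5)) ^ 6 ∧
    2 * (x : ℝ) + 2 ≤ (x : ℝ) ^ ((1 : ℝ) / 2 - 2 * ε) * ((x : ℝ) ^ ((1 : ℝ) / 5)) ^ 3 ∧
    32 * (2 * (x : ℝ) / (x : ℝ) ^ ((1 : ℝ) / 5) + Nat.sqrt (2 * x + 2) + 1) ≤
      200 * (x : ℝ) ^ ((4 : ℝ) / 5) := by
  have hx1 : (1 : ℝ) < x := by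
    have : (2 : ℕ) ^ 100 ≤ x := hx
    have h2 : 1 < (2 : ℕ) ^ 100 := by norm_num
    exact_mod_cast h2.trans_le this
  have hx0 : (0 : ℝ) < x := by linarith
  have h50 := four_le_rpow_fiftieth hx
  have e3 : ((x : ℝ) ^ ((1 : ℝ) / 5)) ^ 3 = (x : ℝ) ^ ((3 : ℝ) / 5) := by
    rw [← Real.rpow_natCast, ← Real.rpow_mul hx0.le]; norm_num
  have e6 : ((x : ℝ) ^ ((1 : ℝ) / 5)) ^ 6 = (x : ℝ) * (x : ℝ) ^ ((1 : ℝ) / 5) := by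
    rw [← Real.rpow_natCast, ← Real.rpow_mul hx0.le]
    have : (x : ℝ) * (x : ℝ) ^ ((1 : ℝ) / 5) = (x : ℝ) ^ (1 + (1 : ℝ) / 5) := by
      rw [Real.rpow_add hx0, Real.rpow_one]
    rw [this]; norm_num
  have eD2 : ((x : ℝ) ^ ((1 : ℝ) / 2 - 2 * ε)) ^ 2 = (x : ℝ) ^ (1 - 4 * ε) := by
    rw [← Real.rpow_natCast, ← Real.rpow_mul hx0.le]; ring_nf
  have h15 : (x : ℝ) ^ ((1 : ℝ) / 50) ≤ (x : ℝ) ^ ((1 : ℝ) / 5) :=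
    Real.rpow_le_rpow_of_exponent_le hx1.le (by norm_num)
  have h45 : (1 : ℝ) ≤ (x : ℝ) ^ ((4 : ℝ) / 5) := Real.one_le_rpow hx1.le (by norm_num)
  refine ⟨Real.one_le_rpow hx1.le (by norm_num), Real.one_le_rpow hx1.le (by linarith),
    Real.rpow_le_rpow_of_exponent_le hx1.le (by nlinarith), ?_, ?_, ?_, ?_, ?_, ?_⟩
  · rw [e3]; exact Real.rpow_lt_rpow_of_exponent_lt hx1 (by linarith)
  · rw [eD2]
    conv_rhs => rw [← Real.rpow_one (x : ℝ)]
    exact Real.rpow_le_rpow_of_exponent_le hx1.le (by linarith)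
  · conv_rhs => rw [← Real.rpow_one (x : ℝ)]
    exact Real.rpow_le_rpow_of_exponent_le hx1.le (by norm_num)
  · rw [e6]; nlinarith
  · rw [e3, ← Real.rpow_add hx0]
    have h1 : (x : ℝ) ^ (1 + (1 : ℝ) / 50) ≤ (x : ℝ) ^ ((1 : ℝ) / 2 - 2 * ε + 3 / 5) :=
      Real.rpow_le_rpow_of_exponent_le hx1.le (by linarith)
    have h2 : (x : ℝ) ^ (1 + (1 : ℝ) / 50) = x * (x : ℝ) ^ ((1 : ℝ) / 50) := by
      rw [Real.rpow_add hx0, Real.rpow_one]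
    nlinarith
  · have ey : 2 * (x : ℝ) / (x : ℝ) ^ ((1 : ℝ) / 5) = 2 * (x : ℝ) ^ ((4 : ℝ) / 5) := by
      rw [div_eq_iff (by positivity), mul_assoc, ← Real.rpow_add hx0]; norm_num
    have hs : ((Nat.sqrt (2 * x + 2) : ℕ) : ℝ) ≤ 2 * (x : ℝ) ^ ((4 : ℝ) / 5) := by
      have h1 : ((Nat.sqrt (2 * x + 2) : ℕ) : ℝ) ^ 2 ≤ 2 * (x : ℝ) + 2 := by
        exact_mod_cast Nat.sqrt_le' (2 * x + 2)
      have h2 : (x : ℝ) ≤ ((x : ℝ) ^ ((4 : ℝ) / 5)) ^ 2 := by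
        rw [← Real.rpow_natCast, ← Real.rpow_mul hx0.le]
        conv_lhs => rw [← Real.rpow_one (x : ℝ)]
        exact Real.rpow_le_rpow_of_exponent_le hx1.le (by norm_num)
      have h0 : (0 : ℝ) ≤ ((Nat.sqrt (2 * x + 2) : ℕ) : ℝ) := Nat.cast_nonneg _
      nlinarith
    rw [ey]; nlinarith

/-! ### The stub -/

set_option maxHeartbeats 800000 in
/-- **Stub `stub_calibReduction`** of skeleton `calib-split` (crux `PlainSplit`, stmt-Parity-18382):
the exact split `Σ_rough λΦ = A_w − A_y` and the pointwise inequality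
`−λ(m)G(m) ≥ 1[m prime] − 1[D < P⁻(m), Ω = 2] − 2·1[Ω = 3] − 32·1[m not squarefree]` on
`y`-rough `m`, summed over the window, with `≤ 200 x^{4/5}/32` non-squarefree rough shifts;
valid for `x ≥ 2^100`. -/
theorem stub_calibReduction : ∀ ε : ℝ, 0 < ε → ε ≤ 1 / 25 → ∃ x₀ : ℕ, ∀ x : ℕ, x₀ ≤ x → ∀ (z : ℝ) (G Φ : ℕ → ℝ), z = Real.exp (Real.log (Real.log (x : ℝ)) ^ 2) → G = (fun m : ℕ => ∑ d ∈ (Nat.divisors m).filter (fun d : ℕ => (d : ℝ) ≤ (x : ℝ) ^ ((1 : ℝ) / 2 - 2 * ε) ∧ ∀ p ∈ d.primeFactors, (x : ℝ) ^ ((1 : ℝ) / 5) ≤ (p : ℝ)), (ArithmeticFunction.moebius d : ℝ)) → Φ = (fun m : ℕ => if (x : ℝ) ^ (ε ^ 2) ≤ (m.minFac : ℝ) ∧ (m.minFac : ℝ) < (x : ℝ) ^ ((1 : ℝ) / 5) then G m else 0) → (#((Finset.Ioc x (2 * x)).filter (fun n : ℕ => (∀ p ∈ n.primeFactors, z ≤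 (p : ℝ)) ∧ (n + 2).Prime)) : ℝ) - #((Finset.Ioc x (2 * x)).filter (fun n : ℕ => (∀ p ∈ n.primeFactors, z ≤ (p : ℝ)) ∧ (x : ℝ) ^ ((1 : ℝ) / 2 - 2 * ε) < ((n + 2).minFac : ℝ) ∧ ArithmeticFunction.cardFactors (n + 2) = 2)) - 2 * #((Finset.Ioc x (2 * x)).filter (fun n : ℕ => (∀ p ∈ n.primeFactors, z ≤ (p : ℝ)) ∧ (x : ℝ) ^ ((1 : ℝ) / 5) ≤ ((n + 2).minFac : ℝ) ∧ ArithmeticFunction.cardFactors (n + 2) = 3)) - 200 * (x : ℝ) ^ ((4 : ℝ) / 5) + (∑ n ∈ (Finset.Ioc x (2 * x)).filter (fun n : ℕ => (∀ p ∈ n.primeFactors, z ≤ (p : ℝ)) ∧ (x : ℝ) ^ (ε ^ 2) ≤ ((n + 2).minFac : ℝ)), (ArithmeticFunction.liouville (n + 2) : ℝ) * G (n + 2)) ≤ ∑ n ∈ (Finset.Ioc x (2 * x)).filter (fun n : ℕ => ∀ p ∈ n.primeFactors, z ≤ (p : ℝ)), (ArithmeticFunction.liouville (n + 2) : ℝ)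 * Φ (n + 2) := by
  intro ε hε hε25
  refine ⟨2 ^ 100, fun x hx z G Φ _hz hG hΦ => ?_⟩
  obtain ⟨hy1, hD1, hwy, hDy3, hD2x, hyx, hy6, hDy, hnum⟩ := calib_growth hε hε25 hx
  set y : ℝ := (x : ℝ) ^ ((1 : ℝ) / 5) with hydef
  set D : ℝ := (x : ℝ) ^ ((1 : ℝ) / 2 - 2 * ε) with hDdef
  set w : ℝ := (x : ℝ) ^ (ε ^ 2) with hwdef
  have hy0 : 0 < y := by linarith
  -- Step 1: the split `Σ_R λΦ = A_w − A_y`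
  have hΦ' : ∀ m : ℕ, Φ m = if w ≤ (m.minFac : ℝ) ∧ (m.minFac : ℝ) < y then G m else 0 := by
    intro m; rw [hΦ]
  simp only [hΦ']
  rw [sum_liouville_Phi_split (Finset.Ioc x (2 * x)) (fun n : ℕ => ∀ p ∈ n.primeFactors, z ≤ (p : ℝ))
    w y hwy G]
  -- Step 2: the pointwise inequality on `F = {n rough, y ≤ P⁻(n+2)}`
  set F := (Finset.Ioc x (2 * x)).filter (fun n : ℕ => (∀ p ∈ n.primeFactors, z ≤ (p : ℝ)) ∧
    y ≤ ((n + 2).minFac : ℝ)) with hF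
  have hpt : ∀ n ∈ F, (if (n + 2).Prime then (1 : ℝ) else 0) -
      (if D < ((n + 2).minFac : ℝ) ∧ Ω (n + 2) = 2 then 1 else 0) -
      2 * (if Ω (n + 2) = 3 then 1 else 0) - 32 * (if ¬ Squarefree (n + 2) then 1 else 0) ≤
      -((ArithmeticFunction.liouville (n + 2) : ℝ) * G (n + 2)) := by
    intro n hn
    rw [hF, Finset.mem_filter, Finset.mem_Ioc] at hn
    obtain ⟨⟨hn1, hn2⟩, -, hmf⟩ := hn
    have hm0 : n + 2 ≠ 0 := by omega
    have hr : ∀ p ∈ (n + 2).primeFactors, y ≤ (p : ℝ) := by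
      intro p hp
      have h := Nat.minFac_le_of_dvd (Nat.prime_of_mem_primeFactors hp).two_le
        (Nat.dvd_of_mem_primeFactors hp)
      exact hmf.trans (by exact_mod_cast h)
    have hGm : G (n + 2) = ∑ d ∈ (Nat.divisors (n + 2)).filter (fun d : ℕ => (d : ℝ) ≤ D),
        (μ d : ℝ) := by
      rw [hG]; simp only []; rw [filter_divisors_rough_eq hr hm0]
    have hmx : ((n + 2 : ℕ) : ℝ) ≤ 2 * (x : ℝ) + 2 := by
      have : n + 2 ≤ 2 * x + 2 := by omega
      exact_mod_cast this
    have hmx' : (x : ℝ) < ((n + 2 : ℕ) : ℝ) := by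
      have : x < n + 2 := by omega
      exact_mod_cast this
    rw [hGm, neg_mul_eq_neg_mul]
    refine negLiouville_truncMoebius_ge (y := y) (by omega) hy1 hD1 hDy3 (by linarith) hr
      (cardFactors_le_five_of_rough hm0 hy1 hr (by linarith)) ?_ ?_
    · intro h4 p hp
      have hpp := Nat.prime_of_mem_primeFactors hp
      have hpd := Nat.dvd_of_mem_primeFactors hp
      refine le_of_cofactor_three hm0 hy0 hpd hr ?_ (by linarith)
      have hk0 : (n + 2) / p ≠ 0 := by
        intro h; exact hm0 (by rw [← Nat.mul_div_cancel' hpd, h, mul_zero])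
      have e := ArithmeticFunction.cardFactors_mul (m := p) (n := (n + 2) / p) hpp.ne_zero hk0
      rw [Nat.mul_div_cancel' hpd, ArithmeticFunction.cardFactors_apply_prime hpp] at e
      omega
    · intro h5 d hd hΩd
      have hdd := Nat.dvd_of_mem_divisors hd
      refine le_of_cofactor_three hm0 hy0 hdd hr ?_ (by linarith)
      have hd0 : d ≠ 0 := by rintro rfl; simp at hΩd
      have hk0 : (n + 2) / d ≠ 0 := by
        intro h; exact hm0 (by rw [← Nat.mul_div_cancel' hdd, h, mul_zero])
      have e := ArithmeticFunction.cardFactors_mul (m := d) (n := (n + 2) / d) hd0 hk0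
      rw [Nat.mul_div_cancel' hdd] at e
      omega
  have hsumF := Finset.sum_le_sum hpt
  rw [Finset.sum_sub_distrib, Finset.sum_sub_distrib, Finset.sum_sub_distrib, ← Finset.mul_sum,
    ← Finset.mul_sum, sum_ite_one_eq_card, sum_ite_one_eq_card, sum_ite_one_eq_card,
    sum_ite_one_eq_card, Finset.sum_neg_distrib] at hsumF
  -- Step 3: compare the cardinalities
  have hP : #((Finset.Ioc x (2 * x)).filter (fun n : ℕ => (∀ p ∈ n.primeFactors, z ≤ (p : ℝ)) ∧
      (n + 2).Prime)) ≤ #(F.filter (fun n : ℕ => (n + 2).Prime)) := by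
    refine Finset.card_le_card fun n hn => ?_
    rw [Finset.mem_filter] at hn
    rw [Finset.mem_filter, hF, Finset.mem_filter]
    refine ⟨⟨hn.1, hn.2.1, ?_⟩, hn.2.2⟩
    rw [Nat.Prime.minFac_eq hn.2.2]
    have : x < n + 2 := by have := (Finset.mem_Ioc.1 hn.1).1; omega
    exact hyx.trans (by exact_mod_cast this.le)
  have hB : #(F.filter (fun n : ℕ => D < ((n + 2).minFac : ℝ) ∧ Ω (n + 2) = 2)) ≤
      #((Finset.Ioc x (2 * x)).filter (fun n : ℕ => (∀ p ∈ n.primeFactors, z ≤ (p : ℝ)) ∧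
        D < ((n + 2).minFac : ℝ) ∧ Ω (n + 2) = 2)) := by
    refine Finset.card_le_card fun n hn => ?_
    rw [Finset.mem_filter, hF, Finset.mem_filter] at hn
    rw [Finset.mem_filter]
    exact ⟨hn.1.1, hn.1.2.1, hn.2⟩
  have hE : #(F.filter (fun n : ℕ => Ω (n + 2) = 3)) ≤
      #((Finset.Ioc x (2 * x)).filter (fun n : ℕ => (∀ p ∈ n.primeFactors, z ≤ (p : ℝ)) ∧
        y ≤ ((n + 2).minFac : ℝ) ∧ Ω (n + 2) = 3)) := by
    refine Finset.card_le_card fun n hn => ?_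
    rw [Finset.mem_filter, hF, Finset.mem_filter] at hn
    rw [Finset.mem_filter]
    exact ⟨hn.1.1, hn.1.2.1, hn.1.2.2, hn.2⟩
  have hNs : F.filter (fun n : ℕ => ¬ Squarefree (n + 2)) ⊆
      (Finset.Ioc x (2 * x)).filter (fun n : ℕ => ¬ Squarefree (n + 2) ∧ y ≤ ((n + 2).minFac : ℝ)) := by
    intro n hn
    rw [Finset.mem_filter, hF, Finset.mem_filter] at hn
    rw [Finset.mem_filter]
    exact ⟨hn.1.1, hn.2, hn.1.2.2⟩
  have hN : (#(F.filter (fun n : ℕ => ¬ Squarefree (n + 2))) : ℝ) ≤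
      2 * (x : ℝ) / y + Nat.sqrt (2 * x + 2) + 1 := by
    refine le_trans ?_ (card_nonSquarefree_rough_le x hy1)
    exact_mod_cast Finset.card_le_card hNs
  have hP' : (#((Finset.Ioc x (2 * x)).filter (fun n : ℕ => (∀ p ∈ n.primeFactors, z ≤ (p : ℝ)) ∧
      (n + 2).Prime)) : ℝ) ≤ #(F.filter (fun n : ℕ => (n + 2).Prime)) := by exact_mod_cast hP
  have hB' : (#(F.filter (fun n : ℕ => D < ((n + 2).minFac : ℝ) ∧ Ω (n + 2) = 2)) : ℝ) ≤
      #((Finset.Ioc x (2 * x)).filter (fun n : ℕ => (∀ p ∈ n.primeFactors, z ≤ (p : ℝ)) ∧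
        D < ((n + 2).minFac : ℝ) ∧ Ω (n + 2) = 2)) := by exact_mod_cast hB
  have hE' : (#(F.filter (fun n : ℕ => Ω (n + 2) = 3)) : ℝ) ≤
      #((Finset.Ioc x (2 * x)).filter (fun n : ℕ => (∀ p ∈ n.primeFactors, z ≤ (p : ℝ)) ∧
        y ≤ ((n + 2).minFac : ℝ) ∧ Ω (n + 2) = 3)) := by exact_mod_cast hE
  linarith

end Summit.Parity.GeneralizedHardyLittlewood.Theorems.ParityLeakOneFifth
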